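import Summits.QuantumFields.YangMills.Theorems.IR.Negative.OnsetUcFalseOfMonopoleWire

/-!
# Crux `IR` (stmt-QuantumFields-19354), slot of record `af-pincer-Uc`, SC/NSC split (sha16 d9d9d710e4ae01bd, tree
# `Cruxes/IR/Lines/af_pincer_Uc.lean`): FAITHFULNESS IS LOAD-BEARING IN THE LEAD STUB `stub_onsetUcSC` —
# C′ = `OnsetMixingTypicalUKPcSC` WITHOUT `LatticeRep.injective` is FALSE modulo `MonopoleWire`
# (disprove-1 g7, Negative lane; kernel part of memo `pub/ym-beyond/ym-19354-disprove-1/NOT-REFUTED.md` §12)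

STATUS OF THE CUT (verdict of record, memo §12): (B) NOT REFUTED in the kernel.  `stub_onsetUcSC` is exactly the
repaired statement C′ of p521601; its typed kill-world is `WildWireSC` below (weak-coupling non-uniqueness of a cell
marginal across exterior data for a SIMPLY CONNECTED admissible group — open, believed false); `stub_irNSC` is `IR`
restricted to `¬ SimplyConnectedSpace G` (kill-world: a massless weak-coupling `SO(3)` lattice theory satisfying
`LowerBounds` — open).  Nothing here refutes a stub AS TYPED.

WHAT IS PROVED (sorry-free; axioms `propext`, `Classical.choice`, `Quot.sound`).  This module is kept OUTSIDE the
`ConvexGribovBody` route cone: the one input living there — the admissible universal cover of a non-simply-connected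
admissible group (Weyl's covering theorem, PROVED in the tree: `CompactSemisimpleUniversalCover_holds` + crux 16405's
landed `stub_universalCover_of_cover`) — enters as the hypothesis `AdmissibleCover` and is discharged in the 30-line
companion module `OnsetUcSCHomFalseOfMonopoleWireCover` (unconditional headline there).

§1–§2 TRANSPORT OF THE DLR KERNELS ALONG A COVER (general; the `ℤ^d`/boundary-condition companion of crux 16405's
landed torus transport `NonSimplyConnectedLatticeGap.map_wilsonMeasure_comp_of_surjective`): for a continuous
SURJECTIVE homomorphism `π : H →* G` of compact groups, a continuous `ρ : G →* M_N(ℂ)`, every `β`, finite edge set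
`Λ` and exterior datum `η : LGConfig d H`,
`map_coverLift_ymSpecification :
  (ymSpecification (ρ.comp π) β Λ η).map (coverLift π) = ymSpecification ρ β Λ (coverLift π η)`
(`coverLift π W e = π (W e)`; ingredients `tilted_comp_map` — tilting by a pulled-back potential commutes with the
push-forward —, `wilsonBoundaryAction_comp`, `map_coverLift_pi_map_glueWith`).  Hence `WildWireAt.comp` /
`WildWireEachWindow.comp`: a wild wire of `(G, ρ)` (p514971: two exterior data polarising a centre-cell event
`≤ 1/3` vs `≥ 2/3` through `γ_{F'}`, `F' ⊇ collarBlock n`) pulls back to a wild wire of `(H, ρ ∘ π)` with the SAME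
frame, region and probabilities (event `π⁻¹ A`, data any link-wise lifts) — exterior data act on the cell only
through `π`.

§3–§5 THE LOAD-BEARING ANALYSIS.  `OnsetMixingTypicalUKPcSCHom` := C′ with the binder `r : LatticeRep H` replaced by
`(N, ρ : H →* M_N(ℂ), Continuous ρ, ∀ g, ρ g ∈ U(N))` — i.e. C′ WITHOUT FAITHFULNESS (binders of the card
`Cruxes/IR/Ideas/centre-cover-pullback.md`'s `IRCentreBlind`); `OnsetMixingTypicalUKPcSCBlind` := its restriction to
NON-injective `ρ` (binders of the card's `IRCentreBlindNSC`).  Then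
* `onsetMixingTypicalUKPcSC_of_SCHom : …SCHom → OnsetMixingTypicalUKPcSC` (C′ is the faithful instance);
* `centreBlindWireSC_of_monopoleWire : AdmissibleCover → MonopoleWire → CentreBlindWireSC` — the monopole wire of
  an admissible NOT simply connected `(G, r)` (p521601; physics-grade TRUE at `G = SO(3)` by the forced `ℤ₂`-monopole
  world-line) pulls back to the cover `π : H ↠ G` (`H` admissible, simply connected, `π` not injective), where
  `r.ρ ∘ π` is continuous, unitary, NOT injective and wild;
* `not_onsetMixingTypicalUKPcSCBlind_of_monopoleWire : AdmissibleCover → MonopoleWire → ¬ OnsetMixingTypicalUKPcSCBlind`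
  and the HEADLINE `not_onsetMixingTypicalUKPcSCHom_of_monopoleWire : AdmissibleCover → MonopoleWire →
  ¬ OnsetMixingTypicalUKPcSCHom` (`AdmissibleCover` discharged next door: `MonopoleWire → ¬ …SCHom` outright).
Bookkeeping: `onsetMixingTypicalUKPc_iff_sc_and_nsc : OnsetMixingTypicalUKPc ↔ …SC ∧ …NSC`,
`not_onsetMixingTypicalUKPcNSC_of_monopoleWire` (the monopole wire kills exactly the NSC half; C′ = the SC half),
`not_onsetMixingTypicalUKPcSC_of_wildWireSC` (C′'s bet: `¬ WildWireEachWindow r.ρ` for every lattice representation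
of every simply connected admissible `G`).

WHAT THIS ANSWERS (card `centre-cover-pullback`, cruxidea-1 g11, tooth E3 «faithfulness of the dynamical
representation is cosmetic; keep `Function.Injective ρ` OUT of the statements of `I^c_SC`/`X^c`; then the residual
`stub_irNSC` closes at no extra cost via `IR_of_centreBlind'`»).  For the I-stub OF FORMAT Uc the answer is NO,
kernel-checked modulo the same `MonopoleWire` that killed the unsplit stub: the ONLY thing separating C′ (not refuted)
from a statement killed by `MonopoleWire` is `LatticeRep.injective`; a line for the card's `IRCentreBlindNSC` through an
onset statement must use a defect-relativised (GOOD-conditional) format, as the card's «Disproof used» paragraph says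
informally — here a theorem.  Where a proof of C′ must USE faithfulness is thereby located for format Uc: excluding
exterior data that force a `ker ρ`-monopole line through the cell.  No statement, slot, registry or certificate is
changed; the item stays OPEN; `MonopoleWire`, `AdmissibleCover` are hypotheses here, never asserted.
-/

set_option autoImplicit false

noncomputable section

open Filter Topology MeasureTheory
open Literature.MathematicalPhysics.QuantumFieldTheory (LatticeRep IsCompactSimpleLieGroup haarProbability)
open Literature.MathematicalPhysics.QuantumLattice
open Literature.Probability.LatticeModels
open Summit.QuantumFields.YangMills.Cruxes.IR.ShellTempered (windowCellsPlus)
open Summit.QuantumFields.YangMills.Cruxes.IR.Tempered (windowCells cellEdges regionEdges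
  measurable_wilsonBoundaryAction_of_continuous)
open Summit.QuantumFields.YangMills.Cruxes.IR.OnsetFormats (shellCount)
open Summit.QuantumFields.YangMills.Cruxes.IR.FixedMesh (sixteen_mul_eps_lt_one)

namespace Summit.QuantumFields.YangMills.Cruxes.IR.OnsetFormatsUc

/-! ## §1 Tilting commutes with push-forward along a pulled-back potential -/

/-- For a measurable map `L` and a measurable potential `f` on the target, pushing forward the measure tilted by
the pulled-back potential `f ∘ L` is tilting the push-forward: `(μ.tilted (f ∘ L)).map L = (μ.map L).tilted f`
(both have normaliser `∫ e^{f∘L} dμ` and charge a measurable `s` by `∫_{L⁻¹ s} e^{f∘L}/Z dμ`; change of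
variables `setLIntegral_map`, `integral_map`). [folklore] -/
theorem tilted_comp_map {α γ : Type*} [MeasurableSpace α] [MeasurableSpace γ] (μ : Measure α)
    {L : α → γ} (hL : Measurable L) {f : γ → ℝ} (hf : Measurable f) :
    (μ.tilted fun x => f (L x)).map L = (μ.map L).tilted f := by
  ext s hs
  rw [Measure.map_apply hL hs, tilted_apply' _ _ (hL hs), tilted_apply' _ _ hs,
    setLIntegral_map hs (hf.exp.div_const _).ennreal_ofReal hL,
    integral_map hL.aemeasurable hf.exp.aestronglyMeasurable]

/-! ## §2 The covering (or any homomorphic) link-wise lift of configurations and the DLR kernels -/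

section Cover

variable {G H : Type} [Group G] [Group H]

/-- Link-wise application of a homomorphism `π : H →* G` to a `ℤ^d` configuration: `(π W)(e) = π (W e)`. -/
def coverLift (π : H →* G) {d : ℕ} (W : LGConfig d H) : LGConfig d G := fun e => π (W e)

/-- `coverLift` evaluated on an edge. -/
theorem coverLift_apply (π : H →* G) {d : ℕ} (W : LGConfig d H) (e : ZdEdge d) : coverLift π W e = π (W e) := rfl

/-- Plaquette holonomies are mapped by `π`. [folklore] -/
theorem plaquetteHolonomyZd_coverLift (π : H →* G) {d : ℕ} (W : LGConfig d H) (x : Site d) (i j : Fin d) :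
    plaquetteHolonomyZd (coverLift π W) x i j = π (plaquetteHolonomyZd W x i j) := by
  simp only [plaquetteHolonomyZd, coverLift, map_mul, map_inv]

/-- The boundary Wilson action of `W` in the pulled-back representation `ρ ∘ π` is the boundary Wilson action of
`π W` in `ρ`. [folklore] -/
theorem wilsonBoundaryAction_comp (π : H →* G) {d N : ℕ} (ρ : G →* Matrix (Fin N) (Fin N) ℂ)
    (Λ : Finset (ZdEdge d)) (W : LGConfig d H) :
    wilsonBoundaryAction (ρ.comp π) Λ W = wilsonBoundaryAction ρ Λ (coverLift π W) := by
  simp only [wilsonBoundaryAction, plaquetteObs, MonoidHom.coe_comp, Function.comp_apply,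
    plaquetteHolonomyZd_coverLift]

/-- Lifting commutes with gluing: `π (ζ η_{Λᶜ}) = (π ζ) (π η)_{Λᶜ}`. [folklore] -/
theorem coverLift_glueWith (π : H →* G) {d : ℕ}
    (Λ : Finset (ZdEdge d)) (ζ : ↥Λ → H) (η : LGConfig d H) :
    coverLift π (glueWith Λ ζ η) = glueWith Λ (fun e => π (ζ e)) (coverLift π η) := by
  funext e
  by_cases he : e ∈ Λ <;> simp only [coverLift, glueWith_apply_mem, glueWith_apply_not_mem, he, not_false_eq_true]

variable [TopologicalSpace G] [IsTopologicalGroup G] [CompactSpace G] [MeasurableSpace G] [BorelSpace G]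
  [TopologicalSpace H] [IsTopologicalGroup H] [CompactSpace H] [MeasurableSpace H] [BorelSpace H]

omit [IsTopologicalGroup G] [CompactSpace G] [IsTopologicalGroup H] [CompactSpace H] in
/-- The link-wise lift is measurable for continuous `π`. [folklore] -/
theorem measurable_coverLift (π : H →* G) (hπ : Continuous π) {d : ℕ} : Measurable (coverLift (d := d) π) :=
  measurable_pi_lambda _ fun e => hπ.measurable.comp (measurable_pi_apply e)

/-- **The a priori measures are transported**: `π_* (Haar_H^{⊗Λ} ⊗ δ_{η_{Λᶜ}}) = Haar_G^{⊗Λ} ⊗ δ_{(π η)_{Λᶜ}}`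
for a continuous SURJECTIVE homomorphism of compact groups (`π_* Haar_H = Haar_G` by uniqueness of Haar measure,
Mathlib `MonoidHom.measurePreserving` — as in crux 16405's `measurePreserving_haarProbability_of_surjective`;
`measurePreserving_pi`). [folklore] -/
theorem map_coverLift_pi_map_glueWith (π : H →* G) (hπ : Continuous π) (hπs : Function.Surjective π)
    {d : ℕ} (Λ : Finset (ZdEdge d)) (η : LGConfig d H) :
    ((Measure.pi fun _ : ↥Λ => haarProbability H).map (glueWith Λ · η)).map (coverLift π) =
      (Measure.pi fun _ : ↥Λ => haarProbability G).map (glueWith Λ · (coverLift π η)) := by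
  have hΦ : MeasurePreserving (fun (ζ : ↥Λ → H) (e : ↥Λ) => π (ζ e))
      (Measure.pi fun _ : ↥Λ => haarProbability H) (Measure.pi fun _ : ↥Λ => haarProbability G) :=
    measurePreserving_pi (fun _ : ↥Λ => haarProbability H) (fun _ : ↥Λ => haarProbability G)
      fun _ => MonoidHom.measurePreserving hπ hπs (by rw [measure_univ, measure_univ])
  have hcomm : coverLift π ∘ (fun ζ : ↥Λ → H => glueWith Λ ζ η) =
      (fun ζ : ↥Λ → G => glueWith Λ ζ (coverLift π η)) ∘ fun (ζ : ↥Λ → H) (e : ↥Λ) => π (ζ e) := by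
    funext ζ
    exact coverLift_glueWith π Λ ζ η
  rw [Measure.map_map (measurable_coverLift π hπ) (measurable_glueWith Λ η), hcomm,
    ← Measure.map_map (measurable_glueWith Λ _) hΦ.measurable, hΦ.map_eq]

/-- **The lattice Yang–Mills DLR kernels are transported along a cover**: for a continuous surjective homomorphism
`π : H →* G` of compact groups and a continuous `ρ`, `(γ^{ρ∘π}_Λ(· | η)).map π = γ^{ρ}_Λ(· | π η)` — the Boltzmann
weight is a pull-back (`wilsonBoundaryAction_comp`), tilting commutes with the push-forward (`tilted_comp_map`), the
a priori measure is transported (`map_coverLift_pi_map_glueWith`).  The `ℤ^d`/boundary-condition companion of crux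
16405's landed torus transport `NonSimplyConnectedLatticeGap.map_wilsonMeasure_comp_of_surjective`. [folklore] -/
theorem map_coverLift_ymSpecification (π : H →* G) (hπ : Continuous π) (hπs : Function.Surjective π)
    {d N : ℕ} (ρ : G →* Matrix (Fin N) (Fin N) ℂ) (hρ : Continuous ρ) (β : ℝ) (Λ : Finset (ZdEdge d)) (η : LGConfig d H) :
    (ymSpecification (ρ.comp π) β Λ η).map (coverLift π) = ymSpecification ρ β Λ (coverLift π η) := by
  simp only [ymSpecification]
  have hf : (fun U : LGConfig d H => -β * wilsonBoundaryAction (ρ.comp π) Λ U) =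
      fun U => (fun V : LGConfig d G => -β * wilsonBoundaryAction ρ Λ V) (coverLift π U) := by
    funext U
    rw [wilsonBoundaryAction_comp]
  rw [hf, tilted_comp_map (f := fun V : LGConfig d G => -β * wilsonBoundaryAction ρ Λ V) _
      (measurable_coverLift π hπ) ((measurable_wilsonBoundaryAction_of_continuous ρ hρ Λ).const_mul (-β)),
    map_coverLift_pi_map_glueWith π hπ hπs Λ η]

/-- Kernel probabilities of pulled-back events: `γ^{ρ∘π}_Λ(π⁻¹ A | η) = γ^{ρ}_Λ(A | π η)`. [folklore] -/
theorem ymSpecification_comp_real_preimage (π : H →* G) (hπ : Continuous π) (hπs : Function.Surjective π)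
    {d N : ℕ} (ρ : G →* Matrix (Fin N) (Fin N) ℂ) (hρ : Continuous ρ) (β : ℝ) (Λ : Finset (ZdEdge d))
    (η : LGConfig d H) {A : Set (LGConfig d G)} (hA : MeasurableSet A) :
    (ymSpecification (ρ.comp π) β Λ η).real (coverLift π ⁻¹' A) =
      (ymSpecification ρ β Λ (coverLift π η)).real A := by
  rw [measureReal_def, measureReal_def, ← Measure.map_apply (measurable_coverLift π hπ) hA,
    map_coverLift_ymSpecification π hπ hπs ρ hρ β Λ η]

/-- **A wild wire is pulled back along a cover**: if two exterior data `ζ₀, ζ₁` polarise a centre-cell event `A`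
through the `(G, ρ)` kernel of `F'`, then any link-wise lifts `ζ̃ᵢ` (`π ζ̃ᵢ = ζᵢ`, by surjectivity) polarise the
pulled-back event `π⁻¹ A` (measurable, read off the same cell's edges) through the `(H, ρ ∘ π)` kernel, with the SAME
probabilities.  Exterior data act on the cell only through `π`. [folklore] -/
theorem WildWireAt.comp {N : ℕ} {ρ : G →* Matrix (Fin N) (Fin N) ℂ} {β : ℝ} {b n : ℕ} (h : WildWireAt ρ β b n)
    (π : H →* G) (hπ : Continuous π) (hπs : Function.Surjective π) (hρ : Continuous ρ) :
    WildWireAt (ρ.comp π) β b n := by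
  obtain ⟨w, hw, A, F', ζ₀, ζ₁, hA, hAdep, hF', h0, h1⟩ := h
  have hlift : ∀ ζ : LGConfig 4 G, coverLift π (fun e => Function.surjInv hπs (ζ e)) = ζ :=
    fun ζ => funext fun e => Function.surjInv_eq hπs (ζ e)
  refine ⟨w, hw, coverLift π ⁻¹' A, F', fun e => Function.surjInv hπs (ζ₀ e),
    fun e => Function.surjInv hπs (ζ₁ e), measurable_coverLift π hπ hA, ?_, hF', ?_, ?_⟩
  · intro σ σ' hσ
    exact hAdep fun e he => by rw [coverLift_apply, coverLift_apply, hσ e he]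
  · rw [ymSpecification_comp_real_preimage π hπ hπs ρ hρ _ _ _ hA, hlift]
    exact h0
  · rw [ymSpecification_comp_real_preimage π hπ hπs ρ hρ _ _ _ hA, hlift]
    exact h1

/-- The each-window wild wire is pulled back along a cover. -/
theorem WildWireEachWindow.comp {N : ℕ} {ρ : G →* Matrix (Fin N) (Fin N) ℂ} (h : WildWireEachWindow ρ)
    (π : H →* G) (hπ : Continuous π) (hπs : Function.Surjective π) (hρ : Continuous ρ) :
    WildWireEachWindow (ρ.comp π) := by
  intro n hn
  obtain ⟨β₀, hβ⟩ := h n hn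
  exact ⟨β₀, fun β hβ0 b hb => (hβ β hβ0 b hb).comp π hπ hπs hρ⟩

end Cover

/-! ## §3 The kill at one representation needs continuity only (faithfulness enters nowhere) -/

section Wire

variable {G : Type} [Group G] [TopologicalSpace G] [IsTopologicalGroup G] [CompactSpace G]
  [MeasurableSpace G] [BorelSpace G]

/-- **An each-window wild wire for a CONTINUOUS `ρ` refutes the onset conclusion at `ρ`** — the proof of
`onsetMixingTypicalUKPcAt_false_of_wildWireEachWindow` (p521601) verbatim with `r.continuous` replaced by a
hypothesis: injectivity and unitarity of `ρ` are never used. -/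
theorem typOnsetUKPcAt_false_of_wildWireEachWindow [T2Space G] [SecondCountableTopology G] {N : ℕ}
    {ρ : G →* Matrix (Fin N) (Fin N) ℂ} (hρ : Continuous ρ) (hW : WildWireEachWindow ρ) :
    ¬ ∃ (n : ℕ) (ε : ℝ), 1 ≤ n ∧ 0 ≤ ε ∧ ε * shellCount n ≤ 3 / 4 ∧
        ∀ δ : ℝ, 0 < δ → ∃ β₂ : ℝ, ∀ β : ℝ, β₂ ≤ β → ∃ b : ℕ, 1 ≤ b ∧ TypShellCondUKPc ρ β b n ε δ := by
  rintro ⟨n, ε, hn, hε0, hM, hIδ⟩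
  obtain ⟨β₀, hwire⟩ := hW n hn
  have h16 : 16 * ε < 1 := sixteen_mul_eps_lt_one (by linarith) hε0
  set k : ℝ := ((windowCellsPlus n \ windowCells n).card : ℝ) with hk
  have hk0 : 0 ≤ k := Nat.cast_nonneg _
  have hδ0 : 0 < 1 / (16 * (k + 1)) := by positivity
  obtain ⟨β₂, hon⟩ := hIδ _ hδ0
  obtain ⟨b, hb, hT⟩ := hon (max β₀ β₂) (le_max_right _ _)
  have hkk : k / (k + 1) < 1 := (div_lt_one (by positivity)).mpr (by linarith)
  have h2 : 16 * (k * (1 / (16 * (k + 1)))) < 1 := by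
    rw [mul_one_div, ← mul_div_assoc, mul_div_mul_left k (k + 1) (by norm_num : (16 : ℝ) ≠ 0)]
    exact hkk
  have hlt : 2 * ε + 2 * (k * (1 / (16 * (k + 1)))) < 1 / 3 := by linarith
  exact not_typShellCondUKPc_of_wildWireAt hρ (hwire _ (le_max_left _ _) b hb) hε0 hδ0.le hlt hT

end Wire

/-! ## §4 Statements: the SC/NSC split of the old stub, C′'s typed kill-world, and C′ WITHOUT FAITHFULNESS -/

/-- The old lead stub's statement restricted to NOT simply connected `G` (the complement of C′). -/
def OnsetMixingTypicalUKPcNSC : Prop :=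
  ∀ (G : Type) [Group G] [TopologicalSpace G] [IsTopologicalGroup G] [CompactSpace G],
    IsCompactSimpleLieGroup G → ¬ SimplyConnectedSpace G →
    letI : MeasurableSpace G := borel G; haveI : BorelSpace G := ⟨rfl⟩;
    ∀ r : LatticeRep G, ∃ (n : ℕ) (ε : ℝ), 1 ≤ n ∧ 0 ≤ ε ∧ ε * shellCount n ≤ 3 / 4 ∧
      ∀ δ : ℝ, 0 < δ → ∃ β₂ : ℝ, ∀ β : ℝ, β₂ ≤ β → ∃ b : ℕ, 1 ≤ b ∧ TypShellCondUKPc r.ρ β b n ε δ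

/-- `OnsetMixingTypicalUKPc ↔ OnsetMixingTypicalUKPcSC ∧ OnsetMixingTypicalUKPcNSC` (excluded middle on
`SimplyConnectedSpace G`, exactly as the slot's `irCal_of_pincerUcSC` branches). -/
theorem onsetMixingTypicalUKPc_iff_sc_and_nsc :
    OnsetMixingTypicalUKPc ↔ OnsetMixingTypicalUKPcSC ∧ OnsetMixingTypicalUKPcNSC := by
  constructor
  · exact fun h => ⟨onsetMixingTypicalUKPcSC_of_UKPc h, fun G _ _ _ _ hG _ => h G hG⟩
  · rintro ⟨hsc, hnsc⟩ G _ _ _ _ hG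
    by_cases hs : SimplyConnectedSpace G
    · exact hsc G hG hs
    · exact hnsc G hG hs

/-- **`MonopoleWire` kills exactly the NSC half.** -/
theorem not_onsetMixingTypicalUKPcNSC_of_monopoleWire (h : MonopoleWire) : ¬ OnsetMixingTypicalUKPcNSC := by
  intro hI
  obtain ⟨G, _, _, _, _, hG, hnsc, hW⟩ := h
  letI : MeasurableSpace G := borel G
  haveI : BorelSpace G := ⟨rfl⟩
  obtain ⟨r, hWr⟩ := hW
  haveI : T2Space G := T2Space.of_injective_continuous r.injective r.continuous
  haveI : SecondCountableTopology G :=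
    (r.continuous.isClosedEmbedding r.injective).isEmbedding.secondCountableTopology
  exact typOnsetUKPcAt_false_of_wildWireEachWindow r.continuous hWr (hI G hG hnsc r)

/-- **C′'s typed kill-world**: an each-window wild wire for some lattice representation of some SIMPLY CONNECTED
admissible `G` (e.g. `SU(N)`: weak-coupling non-uniqueness of the cell marginal across exterior data — open,
believed false; no forced `π₁`-defect exists). -/
def WildWireSC : Prop :=
  ∃ (G : Type) (_ : Group G) (_ : TopologicalSpace G) (_ : IsTopologicalGroup G) (_ : CompactSpace G),
    IsCompactSimpleLieGroup G ∧ SimplyConnectedSpace G ∧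
      (letI : MeasurableSpace G := borel G; haveI : BorelSpace G := ⟨rfl⟩;
        ∃ r : LatticeRep G, WildWireEachWindow r.ρ)

/-- **`WildWireSC → ¬ C′`**: the lead stub `stub_onsetUcSC` bets `¬ WildWireEachWindow r.ρ` for every lattice
representation of every simply connected admissible `G`. -/
theorem not_onsetMixingTypicalUKPcSC_of_wildWireSC (h : WildWireSC) : ¬ OnsetMixingTypicalUKPcSC := by
  intro hI
  obtain ⟨G, _, _, _, _, hG, hsc, hW⟩ := h
  letI : MeasurableSpace G := borel G
  haveI : BorelSpace G := ⟨rfl⟩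
  obtain ⟨r, hWr⟩ := hW
  haveI : T2Space G := T2Space.of_injective_continuous r.injective r.continuous
  haveI : SecondCountableTopology G :=
    (r.continuous.isClosedEmbedding r.injective).isEmbedding.secondCountableTopology
  exact typOnsetUKPcAt_false_of_wildWireEachWindow r.continuous hWr (hI G hG hsc r)

/-- **C′ WITHOUT FAITHFULNESS** (card `centre-cover-pullback`, tooth E3: «keep `Function.Injective ρ` OUT of the
analytic statements of `I^c_SC`»): the lead stub's conclusion for every simply connected admissible `H` and every
CONTINUOUS UNITARY matrix representation `ρ` of `H` — `LatticeRep` minus `injective`.  Binders as the card's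
`IRCentreBlind`. -/
def OnsetMixingTypicalUKPcSCHom : Prop :=
  ∀ (H : Type) [Group H] [TopologicalSpace H] [IsTopologicalGroup H] [CompactSpace H],
    IsCompactSimpleLieGroup H → SimplyConnectedSpace H →
    letI : MeasurableSpace H := borel H; haveI : BorelSpace H := ⟨rfl⟩;
    ∀ (N : ℕ) (ρ : H →* Matrix (Fin N) (Fin N) ℂ), Continuous ρ →
      (∀ g, ρ g ∈ Matrix.unitaryGroup (Fin N) ℂ) →
      ∃ (n : ℕ) (ε : ℝ), 1 ≤ n ∧ 0 ≤ ε ∧ ε * shellCount n ≤ 3 / 4 ∧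
        ∀ δ : ℝ, 0 < δ → ∃ β₂ : ℝ, ∀ β : ℝ, β₂ ≤ β → ∃ b : ℕ, 1 ≤ b ∧ TypShellCondUKPc ρ β b n ε δ

/-- **The CENTRE-BLIND part of C′ without faithfulness** (binders as the card's `IRCentreBlindNSC`): the same
conclusion for the NON-injective continuous unitary `ρ` only — the representations `r.ρ ∘ π` through which the
card routes the residual `stub_irNSC`. -/
def OnsetMixingTypicalUKPcSCBlind : Prop :=
  ∀ (H : Type) [Group H] [TopologicalSpace H] [IsTopologicalGroup H] [CompactSpace H],
    IsCompactSimpleLieGroup H → SimplyConnectedSpace H →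
    letI : MeasurableSpace H := borel H; haveI : BorelSpace H := ⟨rfl⟩;
    ∀ (N : ℕ) (ρ : H →* Matrix (Fin N) (Fin N) ℂ), Continuous ρ →
      (∀ g, ρ g ∈ Matrix.unitaryGroup (Fin N) ℂ) → ¬ Function.Injective ρ →
      ∃ (n : ℕ) (ε : ℝ), 1 ≤ n ∧ 0 ≤ ε ∧ ε * shellCount n ≤ 3 / 4 ∧
        ∀ δ : ℝ, 0 < δ → ∃ β₂ : ℝ, ∀ β : ℝ, β₂ ≤ β → ∃ b : ℕ, 1 ≤ b ∧ TypShellCondUKPc ρ β b n ε δ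

/-- The faithfulness-free form implies C′ (instantiate at `r.ρ`) … -/
theorem onsetMixingTypicalUKPcSC_of_SCHom (h : OnsetMixingTypicalUKPcSCHom) : OnsetMixingTypicalUKPcSC :=
  fun H _ _ _ _ hH hsc r => h H hH hsc r.N r.ρ r.continuous r.mem_unitary
/-- … and its centre-blind part; so `OnsetMixingTypicalUKPcSCHom → OnsetMixingTypicalUKPcSC ∧ …SCBlind`. -/
theorem onsetMixingTypicalUKPcSCBlind_of_SCHom (h : OnsetMixingTypicalUKPcSCHom) :
    OnsetMixingTypicalUKPcSCBlind := fun H _ _ _ _ hH hsc N ρ hρ hu _ => h H hH hsc N ρ hρ hu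

/-- **The centre-blind wire on a simply connected group**: some simply connected admissible `H` carries a
continuous unitary NON-injective `ρ` with an each-window wild wire. -/
def CentreBlindWireSC : Prop :=
  ∃ (H : Type) (_ : Group H) (_ : TopologicalSpace H) (_ : IsTopologicalGroup H) (_ : CompactSpace H),
    IsCompactSimpleLieGroup H ∧ SimplyConnectedSpace H ∧
      (letI : MeasurableSpace H := borel H; haveI : BorelSpace H := ⟨rfl⟩;
        ∃ (N : ℕ) (ρ : H →* Matrix (Fin N) (Fin N) ℂ), Continuous ρ ∧
          (∀ g, ρ g ∈ Matrix.unitaryGroup (Fin N) ℂ) ∧ ¬ Function.Injective ρ ∧ WildWireEachWindow ρ)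

/-! ## §5 The kills -/

/-- **`CentreBlindWireSC → ¬ OnsetMixingTypicalUKPcSCBlind`** (`T2`/second countability of `H` from the faithful
representation that admissibility `hH.2` provides — NOT from `ρ`). -/
theorem not_onsetMixingTypicalUKPcSCBlind_of_centreBlindWireSC (h : CentreBlindWireSC) :
    ¬ OnsetMixingTypicalUKPcSCBlind := by
  intro hI
  obtain ⟨H, _, _, _, _, hH, hsc, hW⟩ := h
  letI : MeasurableSpace H := borel H
  haveI : BorelSpace H := ⟨rfl⟩
  obtain ⟨N, ρ, hρ, hu, hninj, hWρ⟩ := hW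
  obtain ⟨r⟩ := hH.2
  haveI : T2Space H := T2Space.of_injective_continuous r.injective r.continuous
  haveI : SecondCountableTopology H :=
    (r.continuous.isClosedEmbedding r.injective).isEmbedding.secondCountableTopology
  exact typOnsetUKPcAt_false_of_wildWireEachWindow hρ hWρ (hI H hH hsc N ρ hρ hu hninj)

/-- **The admissible universal cover of a non-simply-connected admissible group** — the shape in which this file
consumes Weyl's covering theorem: every compact simple Lie group `G` (tree sense) that is NOT simply connected is the
image of a SIMPLY CONNECTED compact simple Lie group `H` under a continuous surjective NON-injective homomorphism.
PROVED in the tree (`Literature.RepresentationTheory.CompactGroups.CompactSemisimpleUniversalCover_holds` — Weyl,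
Bröcker–tom Dieck V (7.1)/(7.13) — plus crux 16405's landed topological-group reduction
`NonSimplyConnectedLatticeGap.stub_universalCover_of_cover`, which lives in the `ConvexGribovBody` route cone); it is
discharged in the companion module `OnsetUcSCHomFalseOfMonopoleWireCover` so that THIS module stays outside that cone.
A hypothesis here, never asserted. -/
def AdmissibleCover : Prop :=
  ∀ (G : Type) [Group G] [TopologicalSpace G] [IsTopologicalGroup G] [CompactSpace G],
    IsCompactSimpleLieGroup G → ¬ SimplyConnectedSpace G →
    ∃ (H : Type) (_ : Group H) (_ : TopologicalSpace H) (_ : IsTopologicalGroup H) (_ : CompactSpace H)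
      (π : H →* G), IsCompactSimpleLieGroup H ∧ SimplyConnectedSpace H ∧ Continuous π ∧
        Function.Surjective π ∧ ¬ Function.Injective π

/-- **`MonopoleWire → CentreBlindWireSC` (given the admissible cover)**: pull the monopole wire of `(G, r)` (`G`
admissible, NOT simply connected) back to the cover `π : H ↠ G` (`H` admissible and simply connected, `π` not
injective): `r.ρ ∘ π` is continuous, unitary, NOT injective, and carries the each-window wild wire
(`WildWireEachWindow.comp`). -/
theorem centreBlindWireSC_of_monopoleWire (hcov : AdmissibleCover) (h : MonopoleWire) : CentreBlindWireSC := by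
  obtain ⟨G, _, _, _, _, hG, hnsc, hW⟩ := h
  letI : MeasurableSpace G := borel G
  haveI : BorelSpace G := ⟨rfl⟩
  obtain ⟨r, hWr⟩ := hW
  obtain ⟨H, _, _, _, _, π, hH, hsc, hπ, hπs, hπi⟩ := hcov G hG hnsc
  letI : MeasurableSpace H := borel H
  haveI : BorelSpace H := ⟨rfl⟩
  refine ⟨H, inferInstance, inferInstance, inferInstance, inferInstance, hH, hsc, r.N, r.ρ.comp π,
    r.continuous.comp hπ, fun g => r.mem_unitary (π g), ?_, hWr.comp π hπ hπs r.continuous⟩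
  intro hinj
  exact hπi fun a b hab =>
    hinj (show r.ρ.comp π a = r.ρ.comp π b by rw [MonoidHom.comp_apply, MonoidHom.comp_apply, hab])

/-- **`MonopoleWire → ¬ OnsetMixingTypicalUKPcSCBlind`** (given the admissible cover; unconditional form in the
companion module `OnsetUcSCHomFalseOfMonopoleWireCover`). -/
theorem not_onsetMixingTypicalUKPcSCBlind_of_monopoleWire (hcov : AdmissibleCover) (h : MonopoleWire) :
    ¬ OnsetMixingTypicalUKPcSCBlind :=
  not_onsetMixingTypicalUKPcSCBlind_of_centreBlindWireSC (centreBlindWireSC_of_monopoleWire hcov h)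

/-- **HEADLINE — `MonopoleWire → ¬ OnsetMixingTypicalUKPcSCHom` (given the admissible cover, which the companion
module discharges): faithfulness is load-bearing in `stub_onsetUcSC`.**  The same hypothesis that killed the old
stub (p521601) kills C′-without-`injective`; it misses C′ itself only because `LatticeRep` is faithful. -/
theorem not_onsetMixingTypicalUKPcSCHom_of_monopoleWire (hcov : AdmissibleCover) (h : MonopoleWire) :
    ¬ OnsetMixingTypicalUKPcSCHom :=
  fun hI => not_onsetMixingTypicalUKPcSCBlind_of_monopoleWire hcov h (onsetMixingTypicalUKPcSCBlind_of_SCHom hI)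

end Summit.QuantumFields.YangMills.Cruxes.IR.OnsetFormatsUc

end
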